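import Literature.ModelTheory.ExponentialFields.SemialgebraicTriangulationTheorem
import HarnessLib

/-!
# `C¹`-triangulations of compact semialgebraic sets — proof file IV: reduction to panel beating

Fourth proof file (D-0026: theorems only, no new named facts) for the named fact
`Literature.ModelTheory.ExponentialFields.OhmotoShiota2017_c1Triangulation`.  Following
[OhmotoShiota2017, §3.2, first paragraph], the `C¹` realization is obtained from the semialgebraic
triangulation theorem (`semialgebraic_triangulation`, proof file III) and the **panel beating**
theorem [OhmotoShiota2017, Thm. 3.1]: the triangulating homeomorphism `Ψ : |K| → X` is extended to
a continuous semialgebraic map on the ambient space (semialgebraic Tietze,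
`exists_continuous_semialgebraic_extension`), a panel beating `χ` of `K` with respect to this
extension makes `Ψ ∘ χ` of class `C¹`, and `(K, Ψ ∘ χ)` is the sought triangulation (compatibility
is kept because `χ` preserves every open simplex).  This file proves that reduction:
`c1Triangulation_of_panelBeating`.  The panel beating theorem itself is the object of the following
proof files.

## Main statements (all proved)

* `exists_continuous_semialgebraic_extension_map` — componentwise semialgebraic Tietze extension
  of maps from compact sets.
* `c1Triangulation_of_panelBeating` — [OhmotoShiota2017, Thm. 1.1 from Thm. 2.2 + Thm. 3.1]:
  the panel beating statement for finite complexes implies `OhmotoShiota2017_c1Triangulation`.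

## References

* [OhmotoShiota2017] T. Ohmoto, M. Shiota, *`C¹`-triangulations of semialgebraic sets*,
  J. Topology 10 (2017), §3.1–3.2 (Thm. 3.1, Def. 3.2, Lemma 3.4).
-/

noncomputable section

open Set Filter
open _root_.Topology

namespace Literature.ModelTheory.ExponentialFields

section Glue

open Literature.NumberTheory.Transcendental (IsSemialgebraicFunOn IsSemialgebraicMapOn
  isSemialgebraicMapOn_iff_forall_holds)

/-- Componentwise semialgebraic Tietze extension: a continuous semialgebraic map on a compact
semialgebraic set extends to a continuous semialgebraic map of the ambient space.
[cite: Dries1998, Ch. 8 (3.10)] -/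
theorem exists_continuous_semialgebraic_extension_map {n m : ℕ} {Q : Set (Fin n → ℝ)}
    (hQ : IsCompact Q) (hQs : IsSemialgebraic ℝ Q) {g : (Fin n → ℝ) → (Fin m → ℝ)}
    (hg : IsSemialgebraicMapOn ℝ Q g) (hgc : ContinuousOn g Q) :
    ∃ G : (Fin n → ℝ) → (Fin m → ℝ), Continuous G ∧ IsSemialgebraicMapOn ℝ univ G ∧ EqOn G g Q := by
  have hcoord : ∀ j, ∃ Gj : (Fin n → ℝ) → ℝ, Continuous Gj ∧ IsSemialgebraicFunOn ℝ univ Gj ∧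
      EqOn Gj (fun x => g x j) Q := fun j =>
    exists_continuous_semialgebraic_extension hQ hQs
      ((isSemialgebraicMapOn_iff_forall_holds hQs).mp hg j)
      ((continuous_apply j).comp_continuousOn hgc)
  choose G hGc hGs hGeq using hcoord
  refine ⟨fun x j => G j x, continuous_pi fun j => hGc j,
    IsSemialgebraicMapOn.of_forall isSemialgebraic_univ fun j => hGs j, fun x hx => ?_⟩
  funext j
  exact hGeq j hx

/-- **`C¹` triangulations from panel beating** [OhmotoShiota2017, §3.2, reduction of Thm. 1.1 to
Thm. 3.1]: if every finite simplicial complex `K` in `ℝⁿ` admits, for every continuous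
semialgebraic map `φ : ℝⁿ → ℝᴹ`, a semialgebraic self-homeomorphism `χ` of `ℝⁿ` preserving the
open simplices of `K` with `φ ∘ χ` of class `C¹` (a *panel beating* of `K` with respect to `φ`,
Def. 3.2), then `OhmotoShiota2017_c1Triangulation` holds: triangulate `X` semialgebraically
(`semialgebraic_triangulation`), extend the triangulating homeomorphism to the ambient space and
beat. [cite: OhmotoShiota2017, Thm. 1.1, Thm. 2.2, Thm. 3.1] -/
theorem c1Triangulation_of_panelBeating
    (hPB : ∀ (n M : ℕ) (K : Geometry.SimplicialComplex ℝ (Fin n → ℝ)), K.faces.Finite →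
      ∀ φ : (Fin n → ℝ) → (Fin M → ℝ), Continuous φ → IsSemialgebraicMapOn ℝ univ φ →
        ∃ χ χ' : (Fin n → ℝ) → (Fin n → ℝ), IsSemialgHomeomorphOn ℝ univ univ χ χ' ∧
          (∀ σ ∈ K.faces, χ '' openSimplex ℝ σ = openSimplex ℝ σ) ∧ ContDiff ℝ 1 (φ ∘ χ)) :
    OhmotoShiota2017_c1Triangulation := by
  intro N X hX hXc 𝒜 h𝒜
  obtain ⟨K, Φ, Ψ, hK, hΦ, hcomp⟩ := semialgebraic_triangulation N X hX hXc 𝒜 h𝒜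
  -- extend `Ψ` to the ambient space
  have hKc : IsCompact K.space := Literature.Analysis.Convexity.isCompact_space_of_finite hK
  have hKs : IsSemialgebraic ℝ K.space :=
    IsSemialgebraicMapOn.isSemialgebraic_holds hΦ.isSemialgebraicMapOn_symm
  obtain ⟨Ψ', hΨ'c, hΨ's, hΨ'eq⟩ := exists_continuous_semialgebraic_extension_map hKc hKs
    hΦ.isSemialgebraicMapOn_symm hΦ.continuousOn_symm
  -- beat
  obtain ⟨χ, χ', hχ, hχσ, hC1⟩ := hPB N N K hK Ψ' hΨ'c hΨ's
  have hχK : MapsTo χ K.space K.space := by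
    intro p hp
    obtain ⟨σ, hσ, hpσ⟩ := exists_mem_openSimplex_of_mem_space hp
    have h : χ p ∈ openSimplex ℝ σ := by
      rw [← hχσ σ hσ]
      exact ⟨p, hpσ, rfl⟩
    exact openSimplex_subset_space hσ h
  have hχ'K : MapsTo χ' K.space K.space := by
    intro p hp
    obtain ⟨σ, hσ, hpσ⟩ := exists_mem_openSimplex_of_mem_space hp
    have h : p ∈ χ '' openSimplex ℝ σ := by
      rw [hχσ σ hσ]
      exact hpσ
    obtain ⟨p', hp', rfl⟩ := h
    rw [hχ.left_inv (mem_univ _)]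
    exact openSimplex_subset_space hσ hp'
  refine ⟨N, K, Ψ' ∘ χ, χ' ∘ Φ, hK, ⟨?_, ?_, ?_, ?_, ?_, ?_, ?_⟩, hC1, ?_⟩
  · intro p hp
    show Ψ' (χ p) ∈ X
    rw [hΨ'eq (hχK hp)]
    exact hΦ.mapsTo_symm (hχK hp)
  · intro x hx
    exact hχ'K (hΦ.mapsTo hx)
  · intro p hp
    show χ' (Φ (Ψ' (χ p))) = p
    rw [hΨ'eq (hχK hp), hΦ.right_inv (hχK hp), hχ.left_inv (mem_univ _)]
  · intro x hx
    show Ψ' (χ (χ' (Φ x))) = x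
    rw [hχ.right_inv (mem_univ _), hΨ'eq (hΦ.mapsTo hx), hΦ.left_inv hx]
  · exact hΨ'c.comp_continuousOn (hχ.continuousOn.mono (subset_univ _))
  · exact (hχ.continuousOn_symm.mono (subset_univ _)).comp hΦ.continuousOn
      (fun x _ => mem_univ _)
  · exact IsSemialgebraicMapOn.comp_holds hΨ's (hχ.isSemialgebraicMapOn.mono (subset_univ _) hKs)
      (mapsTo_univ _ _)
  · intro A hA σ hσ hne
    have himg : (Ψ' ∘ χ) '' openSimplex ℝ σ = Ψ '' openSimplex ℝ σ := by
      rw [image_comp, hχσ σ hσ]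
      exact image_congr fun p hp => hΨ'eq (openSimplex_subset_space hσ hp)
    rw [himg] at hne ⊢
    exact hcomp A hA σ hσ hne

end Glue

end Literature.ModelTheory.ExponentialFields
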